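/-
Copyright (c) 2026 the pub-hodgecm-mathlib formalisation cell (harness21).  Prover seat hodgecm-mathlib-K2Liu-p03 (g7): Track B «K2-LIT»,
#184♮ = hLiu418 = stmt-HodgeConjecture-24832, road `K2_Liu`, socket #42S payer road, organ S4 (glue), piece (S4-loc-b) «the conjugation `ψ_T` by `1 ⊗ T`»
(LEAD F0P6-plan (g13) RULING «M-157l» (4) ∕ 09:22:09Z (2) ∕ 09:45:33Z (2); g6 HANDOFF `HANDOFF.K2Liu-p03-g6.md` item 1).
-/
import Summits.HodgeConjecture.HodgeConjecture.Theorems.K2LiuLocalSWSectionDefs   -- ★ D-A (K2Liu-p09): `tensorEmbLoc`, `coe_tensorEmbLoc`, `localPi_hermD_tensor_eq`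
import Literature.NumberTheory.Automorphic.LocalUnitaryGroupCongr                 -- ★ `UnitaryGroup.localFormCongr` (local change of basis `g ↦ T g T⁻¹`)
import HarnessLib

/-!
# Crux `HLiu418`, road `K2_Liu`, socket #42S, organ S4, piece (S4-loc-b) — DEFS: THE CHANGE OF FRAME `ψ_T` OF THE BIG LOCAL GROUP `U(𝔻 ⊗ V′)(L⁺_v)`
# INDUCED BY A LOCAL CONGRUENCE `T` OF THE AUXILIARY FRAMES, AND `ψ_T (h ⊗ 1_{V″}) = h ⊗ 1_{V′}`

Cell `hodgecm-mathlib`, crux item hLiu418 = `stmt-HodgeConjecture-24832`; squad K2 ∕ K2Liu; prover K2Liu-p03 (g7).  Definition lane (`--kind definition`,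
`--supports stmt-HodgeConjecture-24832 --as helper`): DEFINITIONS WITH BODIES + their matrix descriptions and the one structural theorem; no instance, no notation,
no named-fact hypothesis, no `sorry`.

SETTING = ★ D-A `K2LiuLocalSWSectionDefs` ∕ ★ (S4-loc) `K2LiuLocalSWImageFrameInvariance` §1: the doubled CM datum `(L, e, dV, dW)` with `H_v = U(𝔻)(L⁺_v) =
localPi … (hermD e dV dW) v`, two auxiliary frames `dV′, dV″ : Fin M₂ → L` (tensor enumerations `eW, e′`), a finite place `v` of `L⁺`, and the BIG local groups
`U(𝔻 ⊗ V′)(L⁺_v)`, `U(𝔻 ⊗ V″)(L⁺_v)` (`localPi … (hermD e′ dV (tensorFrame dW eW dV⋆)) v`, Gram matrix `J^{𝔻⊗V⋆} = reindex epsD (J^𝔻 ⊗ₖ diag dV⋆)`, ★ `hermD_tensor`).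
A LOCAL CONGRUENCE of the auxiliary frames is `T ∈ GL_{M₂}(L ⊗ L⁺_v)` with `ᵗ((c⊗1)T) · diag(dV′)_v · T = a • diag(dV″)_v` (`a` a unit; `a = 1` is what ★ (S4-loc-c)
`exists_formCongr_diagonal_of_hilbertSymbol_eq` produces for two rank-3 frames with the same local sign).
* §1 **`oneKronGL … v T := reindexGL epsD (1_{n+n} ⊗ₖ T) ∈ GL_{n′+n′}(L ⊗ L⁺_v)`** — «`1_𝔻 ⊗ T`» in the big enumeration — and **`formCongr_oneKronGL`**:
  `ᵗ((c⊗1)(1 ⊗ T)) · J^{𝔻⊗V′}_v · (1 ⊗ T) = a • J^{𝔻⊗V″}_v` (`(1 ⊗ T)^* (J^𝔻 ⊗ D′) (1 ⊗ T) = J^𝔻 ⊗ (T^* D′ T)`); **`commute_oneKronGL_kronOneGL`**: `1 ⊗ T` commutes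
  with every `k ⊗ 1` (place by place `(1 ⊗ T_w)(k_w ⊗ 1) = k_w ⊗ T_w = (k_w ⊗ 1)(1 ⊗ T_w)`).
* §2 **`tensorFrameCongrLoc … v T ha hT : U(𝔻 ⊗ V″)(L⁺_v) ≃ₜ* U(𝔻 ⊗ V′)(L⁺_v)`, `g ↦ (1 ⊗ T) g (1 ⊗ T)⁻¹`** — ★ `UnitaryGroup.localFormCongr` at `oneKronGL T`
  transported to the factor form `localPi` through ★ `localPiEquiv` on both sides; `coe_tensorFrameCongrLoc_apply` (the underlying family is
  `B · g · B⁻¹`, `B = localGLPiEquiv (oneKronGL T)`).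
* §3 **`tensorFrameCongrLoc_tensorEmbLoc`**: `ψ_T (h ⊗ 1_{V″}) = h ⊗ 1_{V′}` for every `h ∈ H_v` — the hypothesis `hψ` of ★ (S4-loc-a)
  `localSWImage_comp_eq`, so that `R(V″_v; sB ∘ ψ_T, m₀) = R(V′_v; sB, m₀)` (typed in the companion proof file `K2LiuLocalSWImageFrameCongr`).
The naturality «Kudla's big local Weil datum for `V″` = the datum for `V′` composed with `ψ_T`» is the D-A′ owner's (K2Liu-p09) model statement; this file is the
group-theoretic carrier it is stated on ([Kudla1994, §3 Thm. 3.1]; [MoeglinVignerasWaldspurger1987, Chap. 1 I.17]; [PlatonovRapinchuk1994, §2.3]).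
HONEST LABEL.  Count-neutral helper: `HC_CM` is proved only modulo the 7 printed citations (2 remaining named inputs: hLiu418 = `stmt-HodgeConjecture-24832`,
h413 = `stmt-HodgeConjecture-24833`) until rung 0 closes; this file defines carriers and closes no item.

## References
* [PlatonovRapinchuk1994] V. Platonov, A. Rapinchuk, *Algebraic Groups and Number Theory* (1994), §2.3 (equivalent hermitian forms have conjugate unitary groups), §5.1.
* [Kudla1994] S. S. Kudla, *Splitting metaplectic covers of dual reductive pairs*, Israel J. Math. 87 (1994): §2, §3 Thm. 3.1.
* [MoeglinVignerasWaldspurger1987] C. Mœglin, M.-F. Vignéras, J.-L. Waldspurger, LNM 1291 (1987), Chap. 1 I.17 (the dual pair `U(V) × U(W′) → U(V ⊗ W′)`).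
* [GanQiuTakeda2014] W. T. Gan, Y. Qiu, S. Takeda, Invent. Math. 198 (2014): §5.4–§5.5 (`R_n(V_v)` depends on the isometry class of `V_v`).
-/

set_option autoImplicit false
set_option linter.dupNamespace false -- the mandated namespace repeats `HodgeConjecture.HodgeConjecture`

noncomputable section

open scoped Matrix Kronecker
open NumberField IsDedekindDomain Matrix
open Literature.NumberTheory.Automorphic Literature.NumberTheory.Automorphic.UnitaryGroup
open Literature.NumberTheory.GelbartRogawski1991 Literature.NumberTheory.GelbartRogawski1991.GRConstruction
open Literature.NumberTheory.GelbartRogawski1991.UnitaryDualPair.LocalSplitting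
open Literature.NumberTheory.K2Lit.SiegelDoubled
open Summit.HodgeConjecture.HodgeConjecture.Cruxes.HLiu418.K2LiuLocalSWSectionDefs

namespace Summit.HodgeConjecture.HodgeConjecture.Cruxes.HLiu418.K2LiuLocalTensorFrameCongrDefs

variable (L : Type) [Field L] [NumberField L] [IsCMField L]
variable {N M n : ℕ} (e : Fin N × Fin M ≃ Fin n)
  (dV : Fin N → L) (hdV : ∀ i, IsCMField.complexConj L (dV i) = dV i)
  (dW : Fin M → L) (hdW : ∀ i, IsCMField.complexConj L (dW i) = dW i)
variable {M₂ M' n' : ℕ} (eW : Fin M × Fin M₂ ≃ Fin M') (e' : Fin N × Fin M' ≃ Fin n')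
  (dV' : Fin M₂ → L) (hdV' : ∀ k, IsCMField.complexConj L (dV' k) = dV' k)
  (dV'' : Fin M₂ → L) (hdV'' : ∀ k, IsCMField.complexConj L (dV'' k) = dV'' k)
variable (v : HeightOneSpectrum (𝓞 (Fp L)))

/-! ## §1 `1_𝔻 ⊗ T` in the big enumeration, its form identity and its commutation with `k ⊗ 1` -/

/-- **`oneKronGL v T = reindexGL epsD (1_{n+n} ⊗ₖ T) ∈ GL_{n′+n′}(L ⊗ L⁺_v)`** — the change of frame `1_𝔻 ⊗ T` of the big space `𝔻 ⊗ V′` induced by a change of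
frame `T ∈ GL_{M₂}(L ⊗ L⁺_v)` of the auxiliary space, read in the enumeration `epsD` of ★ `hermD_tensor`. [cite: MoeglinVignerasWaldspurger1987, Chap. 1 I.17]
[cite: Kudla1994, §2 (doubled space, Siegel parabolic)] -/
def oneKronGL (T : GL (Fin M₂) (LocalRing L v)) : GL (Fin (n' + n')) (LocalRing L v) :=
  UnitaryGroup.reindexGL (epsD e eW e') (kroneckerGL ((1 : GL (Fin (n + n)) (LocalRing L v)), T))

omit [IsCMField L] in
/-- matrix of `oneKronGL v T`: `reindex epsD epsD (1 ⊗ₖ T)`. [cite: MoeglinVignerasWaldspurger1987, Chap. 1 I.17] -/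
theorem coe_oneKronGL (T : GL (Fin M₂) (LocalRing L v)) :
    (oneKronGL L e eW e' v T).1 = Matrix.reindex (epsD e eW e') (epsD e eW e') ((1 : Matrix (Fin (n + n)) (Fin (n + n)) (LocalRing L v)) ⊗ₖ T.1) :=
  rfl

omit [IsCMField L] in
/-- `T ↦ 1 ⊗ T` is a group homomorphism: `oneKronGL (T * T′) = oneKronGL T * oneKronGL T′`. [cite: MoeglinVignerasWaldspurger1987, Chap. 1 I.17] -/
theorem oneKronGL_mul (T T' : GL (Fin M₂) (LocalRing L v)) :
    oneKronGL L e eW e' v (T * T') = oneKronGL L e eW e' v T * oneKronGL L e eW e' v T' := by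
  unfold oneKronGL
  rw [← map_mul, ← map_mul, Prod.mk_mul_mk, one_mul]

omit [IsCMField L] in
/-- `oneKronGL 1 = 1`. [cite: MoeglinVignerasWaldspurger1987, Chap. 1 I.17] -/
theorem oneKronGL_one : oneKronGL L e eW e' v (1 : GL (Fin M₂) (LocalRing L v)) = (1 : GL (Fin (n' + n')) (LocalRing L v)) := by
  unfold oneKronGL
  rw [← Prod.one_eq_mk, map_one, map_one]

/-- **THE FORM IDENTITY**: a local congruence `ᵗ((c⊗1)T) · diag(dV′)_v · T = a • diag(dV″)_v` of the auxiliary frames induces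
`ᵗ((c⊗1)(1⊗T)) · J^{𝔻⊗V′}_v · (1⊗T) = a • J^{𝔻⊗V″}_v` on the big Gram matrices (`(1 ⊗ T)^* (J^𝔻 ⊗ D′) (1 ⊗ T) = (1^* J^𝔻 1) ⊗ (T^* D′ T)`, ★ `hermD_tensor`).
[cite: PlatonovRapinchuk1994, §2.3] [cite: Kudla1994, §2 (doubled space, Siegel parabolic)] -/
theorem formCongr_oneKronGL (T : GL (Fin M₂) (LocalRing L v)) {a : LocalRing L v}
    (hT : formCongr (conjLocal L (IsCMField.complexConj L) v) T ((Matrix.diagonal dV').map (algebraMap L (LocalRing L v))) =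
      a • (Matrix.diagonal dV'').map (algebraMap L (LocalRing L v))) :
    formCongr (conjLocal L (IsCMField.complexConj L) v) (oneKronGL L e eW e' v T)
        ((hermD L e' dV hdV (tensorFrame L dW eW dV') (tensorFrame_real L dW hdW eW dV' hdV')).map (algebraMap L (LocalRing L v))) =
      a • (hermD L e' dV hdV (tensorFrame L dW eW dV'') (tensorFrame_real L dW hdW eW dV'' hdV'')).map (algebraMap L (LocalRing L v)) := by
  rw [hermD_tensor L e dV hdV dW hdW eW e' dV' hdV', hermD_tensor L e dV hdV dW hdW eW e' dV'' hdV'', formCongr, coe_oneKronGL,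
    Matrix.reindex_apply, Matrix.reindex_apply, Matrix.reindex_apply, ← Matrix.submatrix_map, ← Matrix.submatrix_map, ← Matrix.submatrix_map,
    Matrix.transpose_submatrix, UnitaryGroup.kronecker_map, UnitaryGroup.kronecker_transpose, Matrix.map_one _ (map_zero _) (map_one _),
    Matrix.transpose_one, ← UnitaryGroup.kronecker_map_map, ← UnitaryGroup.kronecker_map_map, Matrix.submatrix_mul_equiv, Matrix.submatrix_mul_equiv,
    ← Matrix.mul_kronecker_mul, ← Matrix.mul_kronecker_mul, Matrix.one_mul, Matrix.mul_one]
  rw [show (T.1.map (conjLocal L (IsCMField.complexConj L) v))ᵀ * (Matrix.diagonal dV').map (algebraMap L (LocalRing L v)) * T.1 =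
        a • (Matrix.diagonal dV'').map (algebraMap L (LocalRing L v)) from hT, Matrix.kronecker_smul]
  rfl

omit [IsCMField L] in
/-- the `w`-component of `1 ⊗ T` in the factor form `Π_{w∣v} GL(L_w)`: `reindex epsD (1 ⊗ₖ T_w)`, `T_w` the `w`-component of `T`.
[cite: MoeglinVignerasWaldspurger1987, Chap. 1 I.17] -/
theorem coe_localGLPiEquiv_oneKronGL_apply (T : GL (Fin M₂) (LocalRing L v)) (w : UnitaryGroup.PlacesOver L v) :
    ((UnitaryGroup.localGLPiEquiv L (n' + n') v (oneKronGL L e eW e' v T) w : GL (Fin (n' + n')) (w.1.adicCompletion L)) :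
        Matrix (Fin (n' + n')) (Fin (n' + n')) (w.1.adicCompletion L)) =
      Matrix.reindex (epsD e eW e') (epsD e eW e')
        ((1 : Matrix (Fin (n + n)) (Fin (n + n)) (w.1.adicCompletion L)) ⊗ₖ
          T.1.map (Pi.evalRingHom (fun w : UnitaryGroup.PlacesOver L v => w.1.adicCompletion L) w)) := by
  rw [UnitaryGroup.localGLPiEquiv, GLn.coe_piEquiv_apply, coe_oneKronGL, Matrix.reindex_apply, Matrix.reindex_apply, ← Matrix.submatrix_map,
    ← UnitaryGroup.kronecker_map_map, Matrix.map_one _ (map_zero _) (map_one _)]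

omit [IsCMField L] in
/-- **`1 ⊗ T` COMMUTES WITH EVERY `k ⊗ 1`**: in `Π_{w∣v} GL_{n′+n′}(L_w)`, `(1 ⊗ T) · (k ⊗ 1) = (k ⊗ 1) · (1 ⊗ T)` (both are `k ⊗ T` place by place).
[cite: MoeglinVignerasWaldspurger1987, Chap. 1 I.17] -/
theorem commute_oneKronGL_kronOneGL (T : GL (Fin M₂) (LocalRing L v)) (k : UnitaryGroup.LocalGLPi L (n + n) v) :
    Commute (UnitaryGroup.localGLPiEquiv L (n' + n') v (oneKronGL L e eW e' v T)) (kronOneGL L (n + n) M₂ (epsD e eW e') v k) := by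
  refine funext fun w => Units.ext ?_
  rw [Pi.mul_apply, Pi.mul_apply, Units.val_mul, Units.val_mul, coe_localGLPiEquiv_oneKronGL_apply, coe_kronOneGL_apply,
    Matrix.reindex_apply, Matrix.reindex_apply, Matrix.submatrix_mul_equiv, Matrix.submatrix_mul_equiv, ← Matrix.mul_kronecker_mul,
    ← Matrix.mul_kronecker_mul, Matrix.one_mul, Matrix.mul_one, Matrix.one_mul, Matrix.mul_one]

/-! ## §2 The change of frame `ψ_T : U(𝔻 ⊗ V″)(L⁺_v) ≃ₜ* U(𝔻 ⊗ V′)(L⁺_v)` -/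

/-- **`ψ_T = tensorFrameCongrLoc … v T ha hT : U(𝔻 ⊗ V″)(L⁺_v) ≃ₜ* U(𝔻 ⊗ V′)(L⁺_v)`, `g ↦ (1 ⊗ T) g (1 ⊗ T)⁻¹`** — for a local congruence
`ᵗ((c⊗1)T) · diag(dV′)_v · T = a • diag(dV″)_v` of the auxiliary frames: ★ `UnitaryGroup.localFormCongr` at `1 ⊗ T` (form identity `formCongr_oneKronGL`), carried to the
factor form `localPi` by ★ `localPiEquiv` on both sides.  An isomorphism of TOPOLOGICAL groups (so `sB ∘ ψ_T` is again a continuous local Weil datum).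
[cite: PlatonovRapinchuk1994, §2.3] [cite: Kudla1994, §3 Thm. 3.1] -/
def tensorFrameCongrLoc (T : GL (Fin M₂) (LocalRing L v)) {a : LocalRing L v} (ha : IsUnit a)
    (hT : formCongr (conjLocal L (IsCMField.complexConj L) v) T ((Matrix.diagonal dV').map (algebraMap L (LocalRing L v))) =
      a • (Matrix.diagonal dV'').map (algebraMap L (LocalRing L v))) :
    UnitaryGroup.localPi L (IsCMField.complexConj L) (n' + n')
        (hermD L e' dV hdV (tensorFrame L dW eW dV'') (tensorFrame_real L dW hdW eW dV'' hdV'')) v ≃ₜ*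
      UnitaryGroup.localPi L (IsCMField.complexConj L) (n' + n')
        (hermD L e' dV hdV (tensorFrame L dW eW dV') (tensorFrame_real L dW hdW eW dV' hdV')) v :=
  (UnitaryGroup.localPiEquiv L (IsCMField.complexConj L) (n' + n') _ v).trans
    ((UnitaryGroup.localFormCongr (IsCMField.complexConj L) v (oneKronGL L e eW e' v T) ha
        (formCongr_oneKronGL L e dV hdV dW hdW eW e' dV' hdV' dV'' hdV'' v T hT)).trans
      (UnitaryGroup.localPiEquiv L (IsCMField.complexConj L) (n' + n') _ v).symm)

/-- **underlying family of `ψ_T g`**: `B · g · B⁻¹` with `B = localGLPiEquiv (1 ⊗ T) ∈ Π_{w∣v} GL_{n′+n′}(L_w)`. [cite: PlatonovRapinchuk1994, §2.3] -/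
theorem coe_tensorFrameCongrLoc_apply (T : GL (Fin M₂) (LocalRing L v)) {a : LocalRing L v} (ha : IsUnit a)
    (hT : formCongr (conjLocal L (IsCMField.complexConj L) v) T ((Matrix.diagonal dV').map (algebraMap L (LocalRing L v))) =
      a • (Matrix.diagonal dV'').map (algebraMap L (LocalRing L v)))
    (g : UnitaryGroup.localPi L (IsCMField.complexConj L) (n' + n')
        (hermD L e' dV hdV (tensorFrame L dW eW dV'') (tensorFrame_real L dW hdW eW dV'' hdV'')) v) :
    ((tensorFrameCongrLoc L e dV hdV dW hdW eW e' dV' hdV' dV'' hdV'' v T ha hT g :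
        UnitaryGroup.localPi L (IsCMField.complexConj L) (n' + n')
          (hermD L e' dV hdV (tensorFrame L dW eW dV') (tensorFrame_real L dW hdW eW dV' hdV')) v) : UnitaryGroup.LocalGLPi L (n' + n') v) =
      UnitaryGroup.localGLPiEquiv L (n' + n') v (oneKronGL L e eW e' v T) * (g : UnitaryGroup.LocalGLPi L (n' + n') v) *
        (UnitaryGroup.localGLPiEquiv L (n' + n') v (oneKronGL L e eW e' v T))⁻¹ := by
  rw [tensorFrameCongrLoc, ContinuousMulEquiv.trans_apply, ContinuousMulEquiv.trans_apply, UnitaryGroup.coe_localPiEquiv_symm_apply,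
    UnitaryGroup.coe_localFormCongr_apply, UnitaryGroup.coe_localPiEquiv_apply, map_mul, map_mul, map_inv, ContinuousMulEquiv.apply_symm_apply]

/-- the intertwining form without inverses: `ψ_T g · B = B · g`. [cite: PlatonovRapinchuk1994, §2.3] -/
theorem coe_tensorFrameCongrLoc_mul (T : GL (Fin M₂) (LocalRing L v)) {a : LocalRing L v} (ha : IsUnit a)
    (hT : formCongr (conjLocal L (IsCMField.complexConj L) v) T ((Matrix.diagonal dV').map (algebraMap L (LocalRing L v))) =
      a • (Matrix.diagonal dV'').map (algebraMap L (LocalRing L v)))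
    (g : UnitaryGroup.localPi L (IsCMField.complexConj L) (n' + n')
        (hermD L e' dV hdV (tensorFrame L dW eW dV'') (tensorFrame_real L dW hdW eW dV'' hdV'')) v) :
    ((tensorFrameCongrLoc L e dV hdV dW hdW eW e' dV' hdV' dV'' hdV'' v T ha hT g :
        UnitaryGroup.localPi L (IsCMField.complexConj L) (n' + n')
          (hermD L e' dV hdV (tensorFrame L dW eW dV') (tensorFrame_real L dW hdW eW dV' hdV')) v) : UnitaryGroup.LocalGLPi L (n' + n') v) *
        UnitaryGroup.localGLPiEquiv L (n' + n') v (oneKronGL L e eW e' v T) =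
      UnitaryGroup.localGLPiEquiv L (n' + n') v (oneKronGL L e eW e' v T) * (g : UnitaryGroup.LocalGLPi L (n' + n') v) := by
  rw [coe_tensorFrameCongrLoc_apply, inv_mul_cancel_right]

/-! ## §3 `ψ_T` fixes `h ⊗ 1` -/

/-- **`ψ_T (h ⊗ 1_{V″}) = h ⊗ 1_{V′}`** for every `h ∈ U(𝔻)(L⁺_v)`: `1 ⊗ T` commutes with `h ⊗ 1` (`commute_oneKronGL_kronOneGL`), and the two tensor embeddings
have the same underlying family `reindex epsD (h ⊗ₖ 1)` (★ `coe_tensorEmbLoc`).  This is the hypothesis `hψ` of ★ (S4-loc-a) `localSWImage_comp_eq`: the local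
Siegel–Weil image transported along `ψ_T` is unchanged. [cite: Kudla1994, §3 Thm. 3.1] [cite: MoeglinVignerasWaldspurger1987, Chap. 1 I.17] -/
theorem tensorFrameCongrLoc_tensorEmbLoc (T : GL (Fin M₂) (LocalRing L v)) {a : LocalRing L v} (ha : IsUnit a)
    (hT : formCongr (conjLocal L (IsCMField.complexConj L) v) T ((Matrix.diagonal dV').map (algebraMap L (LocalRing L v))) =
      a • (Matrix.diagonal dV'').map (algebraMap L (LocalRing L v)))
    (h : UnitaryGroup.localPi L (IsCMField.complexConj L) (n + n) (hermD L e dV hdV dW hdW) v) :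
    tensorFrameCongrLoc L e dV hdV dW hdW eW e' dV' hdV' dV'' hdV'' v T ha hT (tensorEmbLoc L e dV hdV dW hdW eW e' dV'' hdV'' v h) =
      tensorEmbLoc L e dV hdV dW hdW eW e' dV' hdV' v h := by
  apply Subtype.ext
  rw [coe_tensorFrameCongrLoc_apply, coe_tensorEmbLoc, coe_tensorEmbLoc, (commute_oneKronGL_kronOneGL L e eW e' v T _).eq, mul_inv_cancel_right]

/-- pointwise-functional form: `ψ_T ∘ (· ⊗ 1_{V″}) = (· ⊗ 1_{V′})` as monoid homomorphisms `U(𝔻)(L⁺_v) →* U(𝔻 ⊗ V′)(L⁺_v)`. [cite: Kudla1994, §3 Thm. 3.1] -/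
theorem tensorFrameCongrLoc_comp_tensorEmbLoc (T : GL (Fin M₂) (LocalRing L v)) {a : LocalRing L v} (ha : IsUnit a)
    (hT : formCongr (conjLocal L (IsCMField.complexConj L) v) T ((Matrix.diagonal dV').map (algebraMap L (LocalRing L v))) =
      a • (Matrix.diagonal dV'').map (algebraMap L (LocalRing L v))) :
    (tensorFrameCongrLoc L e dV hdV dW hdW eW e' dV' hdV' dV'' hdV'' v T ha hT).toMonoidHom.comp (tensorEmbLoc L e dV hdV dW hdW eW e' dV'' hdV'' v) =
      tensorEmbLoc L e dV hdV dW hdW eW e' dV' hdV' v :=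
  MonoidHom.ext fun h => tensorFrameCongrLoc_tensorEmbLoc L e dV hdV dW hdW eW e' dV' hdV' dV'' hdV'' v T ha hT h

end Summit.HodgeConjecture.HodgeConjecture.Cruxes.HLiu418.K2LiuLocalTensorFrameCongrDefs

end
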